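import Mathlib
import HarnessLib
import Literature.NumberTheory.LFunctions.VinogradovMeanValueStepA
import Literature.NumberTheory.LFunctions.VinogradovMeanValueLinnik

/-!
# Vinogradov's mean value theorem, V: the first class (Ivić, proof of Lemma 6.2, `J₁'`)

Topic `Literature/NumberTheory/LFunctions`. Everything in this file is PROVED (no named facts).

Continuation of `VinogradovMeanValueStepA.lean` (set-up, the second class `J₂`) and
`VinogradovMeanValueLinnik.lean` (Ivić's Lemma 6.1). In the notation there (`p` a prime, the box
`[1, pP₁]` = `VMV.IQ p P₁`, digits `X = x + py`, `x ∈ [1, p]`, `y ∈ [0, P₁)` = `VMV.Yset P₁`,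
`S_x(α) = ∑_y e(α·ν(x + py))` = `VMV.Sx`), this file bounds Ivić's `J₁'`: the number of solutions
`(X, Y) ∈ [1, pP₁]^{n+s} × [1, pP₁]^{n+s}` of `∑_i X_i^j = ∑_i Y_i^j` (`1 ≤ j ≤ n`) in which the
FIRST `n` coordinates of `X` have pairwise distinct digits `x_i`, and likewise for `Y`
(`VMV.firstClassProd n s p P₁`, written in product coordinates `X = (u, z)`, `u ∈ [1,pP₁]^n`,
`z ∈ [1,pP₁]^s`):

* `firstClassProd_le_sum_Nx` — Hölder (Ivić p. 150):
  `J₁' = ∫ |D|² |f|^{2s} ≤ p^{2s−1} ∑_{x ≤ p} ∫ |D|² |S_x|^{2s} = p^{2s-1} ∑_{x ≤ p} N(x)`, where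
  `D = ∑_{u : digits distinct} e(α·s(u))`, `f = ∑_x S_x`, and `N(x)` (`VMV.Nx`) is the number of
  solutions of the system with the last `s` variables on each side all having low digit `x`;
* `Nx_le` — the count (Ivić p. 150–151, (6.25)): translating by `−x`, the last variables become
  `p y_i`, so modulo `p^j` the `j`-th equation only involves the first `n` variables on each
  side; for fixed right-hand side `u'` the `u` are counted by Linnik's lemma
  (`VMV.linnik_lemma`, with `m pⁿ ≥ pP₁`), and for fixed `(u, u')` the `(y, y')` by
  `J_{s,n}([0,P₁); λ) ≤ J_{s,n}([0,P₁))` (Ivić (6.10), `VMV.Jc_le_J`):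
  `N(x) ≤ (pP₁)ⁿ · n! mⁿ p^{n(n−1)/2} · J_{s,n}([0, P₁))`;
* `firstClassProd_le` — together:
  `J₁' ≤ p^{2s} (pP₁)ⁿ n! mⁿ p^{n(n−1)/2} J_{s,n}([0,P₁))`.

The recurrent inequality itself (Lemma 6.2: the reduction of all nondegenerate solutions to
`J₁'` by a choice of positions, the second class, and the choice of the prime `p`) is assembled in
the next file.

## References

* A. Ivić, *The Riemann Zeta-Function*, John Wiley & Sons 1985 (Dover 2003), §6.2, proof of
  Lemma 6.2, pp. 149–151, (6.25). [cite: Ivic1985, Lemma 6.2]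
-/

noncomputable section

open Finset MeasureTheory Complex
open scoped Real ComplexConjugate

namespace Literature.NumberTheory.LFunctions
namespace VMV

/-! ### The index sets -/

/-- Tuples `u ∈ [1, pP₁]^n` whose low digits `x_i = digit p (u_i)` are pairwise distinct
(Ivić: "`x_1, …, x_n` … are distinct numbers"). [cite: Ivic1985, Lemma 6.2 (proof)] -/
def Dinj (n p P₁ : ℕ) : Finset (Fin n → ℤ) :=
  (tuples n (IQ p P₁)).filter (fun u => Function.Injective (fun i => digit p (u i)))

/-- `#[1, pP₁] = pP₁`. [folklore] -/
theorem card_IQ (p P₁ : ℕ) : (IQ p P₁).card = p * P₁ := by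
  unfold IQ
  rw [Int.card_Icc]
  have : (p : ℤ) * P₁ + 1 - 1 = ((p * P₁ : ℕ) : ℤ) := by push_cast; ring
  rw [this, Int.toNat_natCast]

/-- `#Dinj ≤ (pP₁)ⁿ`. [folklore] -/
theorem card_Dinj_le (n p P₁ : ℕ) : (Dinj n p P₁).card ≤ (p * P₁) ^ n := by
  unfold Dinj
  refine (card_filter_le _ _).trans ?_
  rw [card_tuples, card_IQ]

/-- Ivić's `J₁'` in product coordinates: the number of
`((u, z), (u', z')) ∈ (Dinj × [1,pP₁]^s)²` with `s(u) + s(z) = s(u') + s(z')`.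
[cite: Ivic1985, Lemma 6.2 (proof, `J₁'`)] -/
def firstClassProd (n s p P₁ : ℕ) : ℕ :=
  ((((Dinj n p P₁) ×ˢ tuples s (IQ p P₁)) ×ˢ ((Dinj n p P₁) ×ˢ tuples s (IQ p P₁))).filter
    (fun w => psv n w.1.1 + psv n w.1.2 = psv n w.2.1 + psv n w.2.2)).card

/-- `N(x)`: the number of `((u, y), (u', y')) ∈ (Dinj × [0,P₁)^s)²` with
`s(u) + s(x + py) = s(u') + s(x + py')` — the solutions whose last `s` variables on each side all
have low digit `x` (the count represented by Ivić's integral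
`∫ |∑ S_{x_1}⋯S_{x_n}|² |S(x)|^{2k−2n}`). [cite: Ivic1985, Lemma 6.2 (proof)] -/
def Nx (n s p P₁ : ℕ) (x : ℤ) : ℕ :=
  ((((Dinj n p P₁) ×ˢ tuples s (Yset P₁)) ×ˢ ((Dinj n p P₁) ×ˢ tuples s (Yset P₁))).filter
    (fun w => psv n w.1.1 + psv n (fun l => x + p * w.1.2 l) =
      psv n w.2.1 + psv n (fun l => x + p * w.2.2 l))).card

/-! ### The analytic step: Hölder -/

/-- The generating function of `Dinj × [1,pP₁]^s` factorises: `∑ e(α·(s(u)+s(z))) = D(α) f(α)^s`.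
[folklore] -/
theorem tp_Dinj_prod_eq (n s p P₁ : ℕ) (α : Fin n → ℝ) :
    tp ((Dinj n p P₁) ×ˢ tuples s (IQ p P₁)) (fun w => psv n w.1 + psv n w.2) α =
      tp (Dinj n p P₁) (psv n) α * (fQ n p P₁ α) ^ s := by
  rw [fQ, ← tp_tuples_psv, tp_mul]

/-- The generating function of `Dinj × [0,P₁)^s` with the last variables `x + py`:
`∑ e(α·(s(u)+s(x+py))) = D(α) S_x(α)^s`. [folklore] -/
theorem tp_Dinj_prod_Yset_eq (n s p P₁ : ℕ) (x : ℤ) (α : Fin n → ℝ) :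
    tp ((Dinj n p P₁) ×ˢ tuples s (Yset P₁)) (fun w => psv n w.1 + psv n (fun l => x + p * w.2 l)) α =
      tp (Dinj n p P₁) (psv n) α * (Sx n p P₁ x α) ^ s := by
  rw [Sx_pow, tp_mul]

/-- **Hölder step** (Ivić p. 150: "`J₁' ≤ p^{2k−2n−1} ∫ |∑ S_{x_1}⋯S_{x_n}|² ∑_x |S(x)|^{2k−2n}`"):
for `s ≥ 1` and `p ≥ 1`, `J₁' ≤ p^{2s−1} ∑_{x=1}^{p} N(x)`. [cite: Ivic1985, Lemma 6.2 (proof)] -/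
theorem firstClassProd_le_sum_Nx {n s p P₁ : ℕ} (hp : 0 < p) (hs : 1 ≤ s) :
    (firstClassProd n s p P₁ : ℝ) ≤ (p : ℝ) ^ (2 * s - 1) * ∑ x ∈ Dig p, (Nx n s p P₁ x : ℝ) := by
  classical
  set A₁ := (Dinj n p P₁) ×ˢ tuples s (IQ p P₁) with hA₁
  set v : (Fin n → ℤ) × (Fin s → ℤ) → Fin n → ℤ := fun w => psv n w.1 + psv n w.2 with hv
  -- the count as an integral
  have hcount : (firstClassProd n s p P₁ : ℝ) = ∫ α in box n, ‖tp A₁ v α‖ ^ 2 := by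
    rw [integral_norm_sq_tp]
    rfl
  -- the counts `N(x)` as integrals
  have hNx : ∀ x : ℤ, (Nx n s p P₁ x : ℝ) =
      ∫ α in box n, ‖tp (Dinj n p P₁) (psv n) α * (Sx n p P₁ x α) ^ s‖ ^ 2 := by
    intro x
    simp_rw [← tp_Dinj_prod_Yset_eq]
    rw [integral_norm_sq_tp]
    rfl
  -- pointwise Hölder
  obtain ⟨s', hs'⟩ : ∃ s', 2 * s = s' + 1 := ⟨2 * s - 1, by omega⟩
  have hpt : ∀ α, ‖tp A₁ v α‖ ^ 2 ≤
      (p : ℝ) ^ (2 * s - 1) * ∑ x ∈ Dig p, ‖tp (Dinj n p P₁) (psv n) α * (Sx n p P₁ x α) ^ s‖ ^ 2 := by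
    intro α
    rw [hA₁, hv, tp_Dinj_prod_eq, norm_mul, mul_pow, norm_pow, ← pow_mul, fQ_eq_sum_Sx hp]
    have h1 : ‖∑ x ∈ Dig p, Sx n p P₁ x α‖ ^ (s * 2) ≤
        (p : ℝ) ^ (2 * s - 1) * ∑ x ∈ Dig p, ‖Sx n p P₁ x α‖ ^ (s * 2) := by
      calc ‖∑ x ∈ Dig p, Sx n p P₁ x α‖ ^ (s * 2) ≤ (∑ x ∈ Dig p, ‖Sx n p P₁ x α‖) ^ (s * 2) :=
            pow_le_pow_left₀ (norm_nonneg _) (norm_sum_le _ _) _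
        _ ≤ ((Dig p).card : ℝ) ^ s' * ∑ x ∈ Dig p, ‖Sx n p P₁ x α‖ ^ (s * 2) := by
            rw [show s * 2 = s' + 1 by omega]
            exact pow_sum_le_card_mul_sum_pow (fun x _ => norm_nonneg _) s'
        _ = (p : ℝ) ^ (2 * s - 1) * ∑ x ∈ Dig p, ‖Sx n p P₁ x α‖ ^ (s * 2) := by
            rw [card_Dig, show s' = 2 * s - 1 by omega]
    calc ‖tp (Dinj n p P₁) (psv n) α‖ ^ 2 * ‖∑ x ∈ Dig p, Sx n p P₁ x α‖ ^ (s * 2)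
        ≤ ‖tp (Dinj n p P₁) (psv n) α‖ ^ 2 *
            ((p : ℝ) ^ (2 * s - 1) * ∑ x ∈ Dig p, ‖Sx n p P₁ x α‖ ^ (s * 2)) :=
          mul_le_mul_of_nonneg_left h1 (by positivity)
      _ = (p : ℝ) ^ (2 * s - 1) *
            ∑ x ∈ Dig p, ‖tp (Dinj n p P₁) (psv n) α * (Sx n p P₁ x α) ^ s‖ ^ 2 := by
          rw [mul_sum, mul_sum, mul_sum]
          refine sum_congr rfl fun x _ => ?_
          rw [norm_mul, norm_pow, mul_pow, ← pow_mul]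
          ring
  -- integrate
  have hint : ∀ x : ℤ, Integrable
      (fun α => ‖tp (Dinj n p P₁) (psv n) α * (Sx n p P₁ x α) ^ s‖ ^ 2) (volume.restrict (box n)) := by
    intro x
    refine integrableOn_box_of_continuous_real ?_
    exact (((continuous_tp _ _).mul ((continuous_Sx n p P₁ x).pow _)).norm).pow _
  have hintG : Integrable (fun α => (p : ℝ) ^ (2 * s - 1) *
      ∑ x ∈ Dig p, ‖tp (Dinj n p P₁) (psv n) α * (Sx n p P₁ x α) ^ s‖ ^ 2)
      (volume.restrict (box n)) :=
    (integrable_finsetSum _ fun x _ => hint x).const_mul _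
  rw [hcount]
  calc ∫ α in box n, ‖tp A₁ v α‖ ^ 2
      ≤ ∫ α in box n, (p : ℝ) ^ (2 * s - 1) *
          ∑ x ∈ Dig p, ‖tp (Dinj n p P₁) (psv n) α * (Sx n p P₁ x α) ^ s‖ ^ 2 :=
        integral_mono_of_nonneg (Filter.Eventually.of_forall fun α => by positivity) hintG
          (Filter.Eventually.of_forall hpt)
    _ = (p : ℝ) ^ (2 * s - 1) * ∑ x ∈ Dig p, (Nx n s p P₁ x : ℝ) := by
        rw [integral_const_mul, integral_finsetSum _ (fun x _ => hint x)]
        simp_rw [hNx]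

/-! ### The arithmetic step: counting `N(x)` -/

/-- From a solution `s(u) + s(x + py) = s(u') + s(x + py')`: translating by `−x`,
`s(u − x)_j − s(u' − x)_j = p^j (s(y')_j − s(y)_j)`, so `p^j ∣ s(u − x)_j − s(u' − x)_j`.
[cite: Ivic1985, Lemma 6.2 (proof: "the number of solutions … does not change if `x` is subtracted")] -/
theorem dvd_psv_sub_of_sol {n s : ℕ} {p x : ℤ} {u u' : Fin n → ℤ} {y y' : Fin s → ℤ}
    (h : psv n u + psv n (fun l => x + p * y l) = psv n u' + psv n (fun l => x + p * y' l))
    (j : Fin n) :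
    p ^ (j.val + 1) ∣ psv n (fun i => u i - x) j - psv n (fun i => u' i - x) j := by
  have h1 : psv n (Fin.append u (fun l => x + p * y l)) = psv n (Fin.append u' (fun l => x + p * y' l)) := by
    rw [psv_append, psv_append]; exact h
  have h2 := psv_add_const_eq h1 (-x)
  have e1 : (fun i => Fin.append u (fun l => x + p * y l) i + -x) =
      Fin.append (fun i => u i - x) (fun l => p * y l) := by
    funext i
    refine Fin.addCases (fun i => ?_) (fun i => ?_) i
    · simp only [Fin.append_left]; ring
    · simp only [Fin.append_right]; ring
  have e2 : (fun i => Fin.append u' (fun l => x + p * y' l) i + -x) =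
      Fin.append (fun i => u' i - x) (fun l => p * y' l) := by
    funext i
    refine Fin.addCases (fun i => ?_) (fun i => ?_) i
    · simp only [Fin.append_left]; ring
    · simp only [Fin.append_right]; ring
  rw [e1, e2, psv_append, psv_append] at h2
  have h3 := congr_fun h2 j
  simp only [Pi.add_apply, psv_const_mul] at h3
  exact ⟨psv n y' j - psv n y j, by linear_combination h3⟩

/-- The pairs `(u, u') ∈ Dinj²` compatible modulo prime powers:
`p^j ∣ s(u − x)_j − s(u' − x)_j` for `1 ≤ j ≤ n`. [cite: Ivic1985, Lemma 6.2 (proof)] -/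
def compat (n p P₁ : ℕ) (x : ℤ) : Finset ((Fin n → ℤ) × (Fin n → ℤ)) :=
  ((Dinj n p P₁) ×ˢ (Dinj n p P₁)).filter (fun uu =>
    ∀ j : Fin n, (p : ℤ) ^ (j.val + 1) ∣ psv n (fun i => uu.1 i - x) j - psv n (fun i => uu.2 i - x) j)

/-- **Linnik's lemma applied**: for `u'` fixed, the number of `u ∈ Dinj` compatible with `u'` is at
most `n! mⁿ p^{n(n−1)/2}` whenever `pP₁ ≤ m pⁿ` (the translated box `[1 − x, pP₁ − x]` lies in
`[1 − x, 1 − x + m pⁿ)`, and distinct digits mean pairwise incongruence mod `p`).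
[cite: Ivic1985, Lemma 6.2 (proof, "we may take `m = [Pp^{-n}] + 1`")] -/
theorem card_compat_fibre_le {n p P₁ m : ℕ} (hp : p.Prime) (hnp : n < p)
    (hm : p * P₁ ≤ m * p ^ n) (x : ℤ) (u' : Fin n → ℤ) :
    ((compat n p P₁ x).filter (fun uu => uu.2 = u')).card ≤
      Nat.factorial n * m ^ n * p ^ (n * (n - 1) / 2) := by
  classical
  set μ : Fin n → ℤ := psv n (fun i => u' i - x) with hμ
  refine le_trans ?_ (linnik_lemma hp hnp m (1 - x) μ)
  refine card_le_card_of_injOn (fun uu => fun i => uu.1 i - x) (fun uu huu => ?_) ?_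
  · rw [mem_coe, mem_filter, compat, mem_filter, mem_product] at huu
    obtain ⟨⟨⟨hu, _⟩, hc⟩, rfl⟩ := huu
    rw [Dinj, mem_filter, mem_tuples] at hu
    rw [mem_coe, mem_filter, mem_tuples]
    refine ⟨fun i => ?_, fun i i' hii' hdvd => ?_, fun j => ?_⟩
    · have h1 := hu.1 i
      rw [IQ, Finset.mem_Icc] at h1
      rw [Finset.mem_Ico]
      have hm' : (p : ℤ) * P₁ ≤ (m : ℤ) * (p : ℤ) ^ n := by exact_mod_cast hm
      constructor <;> linarith [h1.1, h1.2]
    · apply hii'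
      apply hu.2
      simp only
      rw [digit_eq_digit_iff]
      simpa using hdvd
    · simpa [hμ, psv] using hc j
  · intro uu huu vv hvv h
    rw [mem_coe, mem_filter] at huu hvv
    have h1 : uu.1 = vv.1 := by
      funext i
      have := congr_fun h i
      simpa using this
    exact Prod.ext h1 (huu.2.trans hvv.2.symm)

/-- `#compat ≤ (pP₁)ⁿ · n! mⁿ p^{n(n−1)/2}`. [cite: Ivic1985, Lemma 6.2 (proof)] -/
theorem card_compat_le {n p P₁ m : ℕ} (hp : p.Prime) (hnp : n < p) (hm : p * P₁ ≤ m * p ^ n)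
    (x : ℤ) :
    (compat n p P₁ x).card ≤ (p * P₁) ^ n * (Nat.factorial n * m ^ n * p ^ (n * (n - 1) / 2)) := by
  classical
  calc (compat n p P₁ x).card
      ≤ (Nat.factorial n * m ^ n * p ^ (n * (n - 1) / 2)) * (Dinj n p P₁).card := by
        refine card_le_mul_card_image_of_maps_to (f := Prod.snd) (fun uu huu => ?_) _
          (fun u' _ => card_compat_fibre_le hp hnp hm x u')
        rw [compat, mem_filter, mem_product] at huu
        exact huu.1.2
    _ ≤ (Nat.factorial n * m ^ n * p ^ (n * (n - 1) / 2)) * (p * P₁) ^ n :=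
        Nat.mul_le_mul_left _ (card_Dinj_le n p P₁)
    _ = (p * P₁) ^ n * (Nat.factorial n * m ^ n * p ^ (n * (n - 1) / 2)) := by ring

/-- For fixed `(u, u')` the `(y, y')` are counted by `J_{s,n}(x + p[0,P₁); λ) ≤ J_{s,n}([0,P₁))`
(Ivić (6.10) on the box `x + p[0, P₁)`, then dilation and translation invariance).
[cite: Ivic1985, Lemma 6.2 (proof: "does not exceed `J_{k−n,n}(P_1)`")] -/
theorem card_Nx_fibre_le {n s p P₁ : ℕ} (hp : 0 < p) (x : ℤ) (uu : (Fin n → ℤ) × (Fin n → ℤ)) :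
    (((((Dinj n p P₁) ×ˢ tuples s (Yset P₁)) ×ˢ ((Dinj n p P₁) ×ˢ tuples s (Yset P₁))).filter
      (fun w => psv n w.1.1 + psv n (fun l => x + p * w.1.2 l) =
        psv n w.2.1 + psv n (fun l => x + p * w.2.2 l))).filter
        (fun w => (w.1.1, w.2.1) = uu)).card ≤ J n s (Yset P₁) := by
  classical
  have hp' : (p : ℤ) ≠ 0 := by exact_mod_cast hp.ne'
  set I' : Finset ℤ := ((Yset P₁).image (fun t => (p : ℤ) * t)).image (· + x) with hI'
  have hJ : J n s I' = J n s (Yset P₁) := by rw [hI', J_translate, J_dilate _ _ _ hp']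
  set c : Fin n → ℤ := psv n uu.2 - psv n uu.1 with hc
  rw [← hJ]
  refine le_trans ?_ (Jc_le_J n s I' c)
  unfold Jc
  refine card_le_card_of_injOn
    (fun w => ((fun l => x + p * w.1.2 l), (fun l => x + p * w.2.2 l))) (fun w hw => ?_) ?_
  · rw [mem_coe, mem_filter, mem_filter, mem_product, mem_product, mem_product] at hw
    obtain ⟨⟨⟨⟨_, hy⟩, _, hy'⟩, heq⟩, huu⟩ := hw
    rw [mem_tuples] at hy hy'
    rw [mem_coe, mem_filter, mem_product, mem_tuples, mem_tuples]
    refine ⟨⟨fun l => ?_, fun l => ?_⟩, ?_⟩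
    · rw [hI']; exact mem_image.2 ⟨_, mem_image.2 ⟨_, hy l, rfl⟩, by ring⟩
    · rw [hI']; exact mem_image.2 ⟨_, mem_image.2 ⟨_, hy' l, rfl⟩, by ring⟩
    · rw [hc, ← huu]
      simp only
      funext j
      have := congr_fun heq j
      simp only [Pi.add_apply, Pi.sub_apply] at this ⊢
      linarith
  · intro w hw w' hw' h
    rw [mem_coe, mem_filter] at hw hw'
    simp only [Prod.mk.injEq] at h
    obtain ⟨h1, h2⟩ := h
    have e12 : w.1.2 = w'.1.2 := by
      funext l; have := congr_fun h1 l
      have : (p : ℤ) * w.1.2 l = p * w'.1.2 l := by linarith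
      exact mul_left_cancel₀ hp' this
    have e22 : w.2.2 = w'.2.2 := by
      funext l; have := congr_fun h2 l
      have : (p : ℤ) * w.2.2 l = p * w'.2.2 l := by linarith
      exact mul_left_cancel₀ hp' this
    have hu := hw.2; have hu' := hw'.2
    rw [← hu', Prod.mk.injEq] at hu
    ext <;> simp [e12, e22, hu.1, hu.2]

/-- **The count** (Ivić (6.25) without the factors `k^{2n}` and `p^{2k−2n}`):
`N(x) ≤ (pP₁)ⁿ · n! mⁿ p^{n(n−1)/2} · J_{s,n}([0,P₁))` for a prime `p > n` and `pP₁ ≤ m pⁿ`.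
[cite: Ivic1985, Lemma 6.2 (proof), (6.25)] -/
theorem Nx_le {n s p P₁ m : ℕ} (hp : p.Prime) (hnp : n < p) (hm : p * P₁ ≤ m * p ^ n) (x : ℤ) :
    Nx n s p P₁ x ≤
      (p * P₁) ^ n * (Nat.factorial n * m ^ n * p ^ (n * (n - 1) / 2)) * J n s (Yset P₁) := by
  classical
  unfold Nx
  calc _ ≤ J n s (Yset P₁) * (compat n p P₁ x).card := by
        refine card_le_mul_card_image_of_maps_to (f := fun w => (w.1.1, w.2.1)) (fun w hw => ?_) _
          (fun uu _ => card_Nx_fibre_le hp.pos x uu)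
        rw [mem_filter, mem_product, mem_product, mem_product] at hw
        rw [compat, mem_filter, mem_product]
        exact ⟨⟨hw.1.1.1, hw.1.2.1⟩, fun j => dvd_psv_sub_of_sol hw.2 j⟩
    _ ≤ J n s (Yset P₁) * ((p * P₁) ^ n * (Nat.factorial n * m ^ n * p ^ (n * (n - 1) / 2))) :=
        Nat.mul_le_mul_left _ (card_compat_le hp hnp hm x)
    _ = _ := by ring

/-- **Ivić's bound for `J₁'`** (the first class with fixed positions):
`J₁' ≤ p^{2s} · (pP₁)ⁿ · n! mⁿ p^{n(n−1)/2} · J_{s,n}([0,P₁))` for a prime `p > n`, `s ≥ 1` and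
`pP₁ ≤ m pⁿ` (Ivić (6.25) up to the factor `k^{2n}` counting the positions).
[cite: Ivic1985, Lemma 6.2 (proof), (6.25)] -/
theorem firstClassProd_le {n s p P₁ m : ℕ} (hp : p.Prime) (hnp : n < p) (hs : 1 ≤ s)
    (hm : p * P₁ ≤ m * p ^ n) :
    (firstClassProd n s p P₁ : ℝ) ≤
      (p : ℝ) ^ (2 * s) * ((p * P₁ : ℕ) : ℝ) ^ n *
        (Nat.factorial n * (m : ℝ) ^ n * (p : ℝ) ^ (n * (n - 1) / 2)) * J n s (Yset P₁) := by
  have hp0 : (0 : ℝ) < p := by exact_mod_cast hp.pos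
  set L : ℝ := ((p * P₁ : ℕ) : ℝ) ^ n *
    (Nat.factorial n * (m : ℝ) ^ n * (p : ℝ) ^ (n * (n - 1) / 2)) * J n s (Yset P₁) with hL
  have hNx : ∀ x : ℤ, (Nx n s p P₁ x : ℝ) ≤ L := by
    intro x
    have := Nx_le (s := s) hp hnp hm x
    rw [hL]; exact_mod_cast this
  calc (firstClassProd n s p P₁ : ℝ) ≤ (p : ℝ) ^ (2 * s - 1) * ∑ x ∈ Dig p, (Nx n s p P₁ x : ℝ) :=
        firstClassProd_le_sum_Nx hp.pos hs
    _ ≤ (p : ℝ) ^ (2 * s - 1) * ∑ _x ∈ Dig p, L := by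
        gcongr with x _
        exact hNx x
    _ = (p : ℝ) ^ (2 * s) * L := by
        rw [sum_const, card_Dig, nsmul_eq_mul, ← mul_assoc, ← pow_succ,
          show 2 * s - 1 + 1 = 2 * s by omega]
    _ = _ := by rw [hL]; ring

end VMV
end Literature.NumberTheory.LFunctions
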